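import Mathlib
import HarnessLib
import Summits.Parity.Statement
import Summits.Parity.BatemanHorn.Theorems.AlmostPrimeZerosSystemLSDRealSegmentClasses

/-!
# Strategist sketch — split of crux `SystemLSDRealSegment` (stmt-Parity-11292) by family class

The three children below are VERBATIM the crux's body under a class hypothesis (crux vocabulary only; written exactly as the
route file writes its items: fully-qualified `Finset.range`, `Filter.Tendsto`, `Literature.NumberTheory.Sieve.*`), and
`SystemLSDRealSegment_of_subs` certifies that the LANDED theorem
`Summit.Parity.BatemanHorn.Cruxes.SystemLSDRealSegment.BetaThinnedRootKernel.systemLSDRealSegment_of_restrictions`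
(Theorems/AlmostPrimeZerosSystemLSDRealSegmentClasses.lean, p106668) glues them to the parent BY NAME (defeq, no rewriting).
-/

namespace Summit.Parity.BatemanHorn.Theses.AlmostPrimeZeros

open scoped BigOperators Topology Manifold Classical MeasureTheory ProbabilityTheory Matrix InnerProductSpace ComplexConjugate ContinuousMap
open Filter Set Function TopologicalSpace MeasureTheory

/-- Child 1 (crux): the real-segment LSD law for Bateman–Horn PAIRS OF LINEAR polynomials (k = 2, both degrees 1; D = 1). -/
def LinearPairSegmentLaw : Prop :=
  ∀ f : Fin 2 → Polynomial ℤ, Literature.NumberTheory.Sieve.IsBatemanHornSystem f → (f 0).natDegree = 1 → (f 1).natDegree = 1 → ∃ Λ : ℂ → ℂ, DifferentiableOn ℂ Λ (Metric.ball 0 2) ∧ Λ 0 = (Literature.NumberTheory.Sieve.batemanHornConst f : ℂ) ∧ ∀ y : ℝ, 5 / 4 < y → y < 7 / 4 → Filter.Tendsto (fun x : ℕ => (x : ℂ)⁻¹ * Complex.exp (((2 : ℕ) : ℂ) * (1 - (y : ℂ)) * (Real.log (Real.log x) : ℂ)) * ∑ n ∈ Finset.range (x + 1), (y : ℂ) ^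 (∑ i, (((f i).eval (n : ℤ)).toNat.factorization.sum fun _ v => min v 2))) Filter.atTop (nhds (Λ y * Complex.exp (((y : ℂ) - 1) * (Real.log (∏ i, ((f i).natDegree : ℝ)) : ℂ)) * (Complex.Gamma y)⁻¹ ^ (2 : ℕ)))

/-- Child 2 (crux): the real-segment LSD law for ONE IRREDUCIBLE QUADRATIC (k = 1, degree 2; D = 2). -/
def QuadraticSegmentLaw : Prop :=
  ∀ f : Fin 1 → Polynomial ℤ, Literature.NumberTheory.Sieve.IsBatemanHornSystem f → (f 0).natDegree = 2 → ∃ Λ : ℂ → ℂ, DifferentiableOn ℂ Λ (Metric.ball 0 2) ∧ Λ 0 = (Literature.NumberTheory.Sieve.batemanHornConst f : ℂ) ∧ ∀ y : ℝ, 5 / 4 < y → y < 7 / 4 → Filter.Tendsto (fun x : ℕ => (x : ℂ)⁻¹ * Complex.exp (((1 : ℕ) : ℂ) * (1 - (y : ℂ)) * (Real.log (Real.log x) : ℂ)) * ∑ n ∈ Finset.range (x + 1), (y : ℂ) ^ (∑ i, (((f i).eval (n : ℤ)).toNat.factorization.sum fun _ v => min v 2))) Filter.atTop (nhds (Λ y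 * Complex.exp (((y : ℂ) - 1) * (Real.log (∏ i, ((f i).natDegree : ℝ)) : ℂ)) * (Complex.Gamma y)⁻¹ ^ (1 : ℕ)))

/-- Child 3 (crux): the real-segment LSD law for every Bateman–Horn system of TOTAL DEGREE Σ deg fᵢ ≥ 3. -/
def HighDegreeSegmentLaw : Prop :=
  ∀ (k : ℕ) (f : Fin k → Polynomial ℤ), Literature.NumberTheory.Sieve.IsBatemanHornSystem f → 3 ≤ ∑ i, (f i).natDegree → ∃ Λ : ℂ → ℂ, DifferentiableOn ℂ Λ (Metric.ball 0 2) ∧ Λ 0 = (Literature.NumberTheory.Sieve.batemanHornConst f : ℂ) ∧ ∀ y : ℝ, 5 / 4 < y → y < 7 / 4 → Filter.Tendsto (fun x : ℕ => (x : ℂ)⁻¹ * Complex.exp ((k : ℂ) * (1 - (y : ℂ)) * (Real.log (Real.log x) : ℂ)) * ∑ n ∈ Finset.range (x + 1), (y : ℂ) ^ (∑ i, (((f i).eval (n : ℤ)).toNat.factorization.sum fun _ v => min v 2))) Filter.atTop (nhds (Λ y * Complex.exp (((y : ℂ) - 1) * (Real.log (∏ i, ((f i).natDegree : ℝ)) :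 ℂ)) * (Complex.Gamma y)⁻¹ ^ k))

/-- The split glue Sub₁ → Sub₂ → Sub₃ → parent, by the LANDED theorem `systemLSDRealSegment_of_restrictions` (p106668):
kernel-checked here that the children's bodies are definitionally the glue's hypotheses. -/
theorem SystemLSDRealSegment_of_subs :
    LinearPairSegmentLaw → QuadraticSegmentLaw → HighDegreeSegmentLaw → SystemLSDRealSegment :=
  fun hP hQ hR =>
    Summit.Parity.BatemanHorn.Cruxes.SystemLSDRealSegment.BetaThinnedRootKernel.systemLSDRealSegment_of_restrictions
      hP hQ hR

/-- The glue SUPPORT ITEM a `route edit --split … --glue` generates has exactly this shape; its proof is the one-liner above. -/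
example : (LinearPairSegmentLaw → QuadraticSegmentLaw → HighDegreeSegmentLaw → SystemLSDRealSegment) :=
  SystemLSDRealSegment_of_subs

/-- Converse bookkeeping (each child is a RESTRICTION of the parent, hence implied by it): the split loses nothing. -/
theorem subs_of_SystemLSDRealSegment (h : SystemLSDRealSegment) :
    LinearPairSegmentLaw ∧ QuadraticSegmentLaw ∧ HighDegreeSegmentLaw :=
  ⟨fun f hf _ _ => h 2 f hf, fun f hf _ => h 1 f hf, fun k f hf _ => h k f hf⟩

end Summit.Parity.BatemanHorn.Theses.AlmostPrimeZeros
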